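import Mathlib
import HarnessLib
import Summits.CriticalPhenomena.Ising3DConformalLimit.Theorems.BernsteinTemperaturePlanarPressureAMCoeff

/-!
# Route BernsteinTemperature, item `PlanarPressureAM` — file C: the complete elliptic series

Helper file (supports item `stmt-CriticalPhenomena-10768`). For a real coefficient sequence `c`
with `|cₙ| ≤ 1` we consider `G(z) = ∑ cₙ zⁿ` and `Φ(z) = ∑ (cₙ/n) zⁿ` on `|z| < 1` and prove

* power series on the unit ball for `G`, `Φ` and `Φ'` (coefficients `cₙ₊₁`), and `z Φ'(z) = G(z) - c₀`;
* under the hypergeometric ratio `4 (n+1)² cₙ₊₁ = (2n+1)² cₙ`, the differential equation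
  `z(1-z) G'' + (1-2z) G' - G/4 = 0` on `|z| < 1` (termwise: the coefficient of `zⁿ` is
  `(n+1)² cₙ₊₁ - (n+½)² cₙ = 0`);
* that `cₙ = (centralBinom n)²/16ⁿ = ((2n choose n)/4ⁿ)²` (for which `G(k²) = (2/π) K(k)` is the
  complete elliptic integral of the first kind) satisfies these hypotheses, with `c₀ = 1`.

No definitions are introduced.
-/

namespace Summit.CriticalPhenomena.Ising3DConformalLimit.Theorems

open Filter Topology FormalMultilinearSeries
open scoped ENNReal NNReal

/-- The hypergeometric ratio of `cₙ = (centralBinom n)²/16ⁿ`: `4 (n+1)² cₙ₊₁ = (2n+1)² cₙ`.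
[folklore] -/
theorem planarPressureAM_c_succ (n : ℕ) :
    4 * ((n : ℝ) + 1) ^ 2 * ((Nat.centralBinom (n + 1) : ℝ) ^ 2 / 16 ^ (n + 1))
      = (2 * (n : ℝ) + 1) ^ 2 * ((Nat.centralBinom n : ℝ) ^ 2 / 16 ^ n) := by
  have h := Nat.succ_mul_centralBinom_succ n
  have h' : ((n : ℝ) + 1) * (Nat.centralBinom (n + 1) : ℝ)
      = 2 * (2 * (n : ℝ) + 1) * (Nat.centralBinom n : ℝ) := by exact_mod_cast h
  have h16 : (16 : ℝ) ^ n ≠ 0 := pow_ne_zero _ (by norm_num)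
  calc 4 * ((n : ℝ) + 1) ^ 2 * ((Nat.centralBinom (n + 1) : ℝ) ^ 2 / 16 ^ (n + 1))
      = (((n : ℝ) + 1) * (Nat.centralBinom (n + 1) : ℝ)) ^ 2 * (4 / 16 ^ (n + 1)) := by ring
    _ = (2 * (2 * (n : ℝ) + 1) * (Nat.centralBinom n : ℝ)) ^ 2 * (4 / 16 ^ (n + 1)) := by rw [h']
    _ = (2 * (n : ℝ) + 1) ^ 2 * ((Nat.centralBinom n : ℝ) ^ 2 / 16 ^ n) := by
        rw [pow_succ]; field_simp; ring

/-- `c₀ = 1` for `cₙ = (centralBinom n)²/16ⁿ`. [folklore] -/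
theorem planarPressureAM_c_zero : ((Nat.centralBinom 0 : ℝ) ^ 2 / 16 ^ 0) = 1 := by
  simp [Nat.centralBinom_zero]

/-- `0 ≤ cₙ ≤ 1` for `cₙ = (centralBinom n)²/16ⁿ`. [folklore] -/
theorem planarPressureAM_c_bounds (n : ℕ) :
    0 ≤ ((Nat.centralBinom n : ℝ) ^ 2 / 16 ^ n) ∧ ((Nat.centralBinom n : ℝ) ^ 2 / 16 ^ n) ≤ 1 := by
  refine ⟨by positivity, ?_⟩
  have h : (Nat.centralBinom n : ℝ) ≤ 4 ^ n := by exact_mod_cast Nat.centralBinom_le_four_pow n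
  have h0 : (0 : ℝ) ≤ Nat.centralBinom n := by positivity
  rw [div_le_one (by positivity)]
  calc (Nat.centralBinom n : ℝ) ^ 2 ≤ (4 ^ n) ^ 2 := pow_le_pow_left₀ h0 h 2
    _ = 16 ^ n := by rw [← pow_mul, mul_comm, pow_mul]; norm_num

/-- `|cₙ| ≤ 1` for `cₙ = (centralBinom n)²/16ⁿ`. [folklore] -/
theorem planarPressureAM_c_abs_le (n : ℕ) : |((Nat.centralBinom n : ℝ) ^ 2 / 16 ^ n)| ≤ 1 := by
  obtain ⟨h0, h1⟩ := planarPressureAM_c_bounds n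
  rw [abs_of_nonneg h0]; exact h1

/-- `G = ∑ cₙ zⁿ` (`|cₙ| ≤ 1`) has a power series on the unit ball. [folklore] -/
theorem planarPressureAM_G_onBall (c : ℕ → ℝ) (hle : ∀ n, |c n| ≤ 1) :
    HasFPowerSeriesOnBall (fun z : ℝ => ∑' n, c n * z ^ n) (ofScalars ℝ c) 0
      (ENNReal.ofReal 1) := by
  apply planarPressureAM_tsum_hasFPowerSeriesOnBall one_pos
  apply planarPressureAM_radius_ge zero_le_one (C := 1)
  intro n
  rw [one_pow, mul_one]
  exact hle n

/-- `Φ = ∑ (cₙ/n) zⁿ` (`|cₙ| ≤ 1`; the `n = 0` term is `c₀/0 = 0`) has a power series on the unit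
ball. [folklore] -/
theorem planarPressureAM_Phi_onBall (c : ℕ → ℝ) (hle : ∀ n, |c n| ≤ 1) :
    HasFPowerSeriesOnBall (fun z : ℝ => ∑' n, (c n / n) * z ^ n)
      (ofScalars ℝ (fun n => c n / n)) 0 (ENNReal.ofReal 1) := by
  apply planarPressureAM_tsum_hasFPowerSeriesOnBall one_pos
  apply planarPressureAM_radius_ge zero_le_one (C := 1)
  intro n
  rw [one_pow, mul_one]
  rcases n with _ | n
  · simp
  · rw [abs_div, Nat.abs_cast]
    calc |c (n + 1)| / ((n + 1 : ℕ) : ℝ) ≤ |c (n + 1)| := by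
          apply div_le_self (abs_nonneg _)
          exact_mod_cast Nat.succ_le_succ (Nat.zero_le n)
      _ ≤ 1 := hle (n + 1)

/-- The derivative of `Φ` has coefficients `cₙ₊₁` on the unit ball. [folklore] -/
theorem planarPressureAM_Phi_deriv_onBall (c : ℕ → ℝ) (hle : ∀ n, |c n| ≤ 1) :
    HasFPowerSeriesOnBall (deriv (fun z : ℝ => ∑' n, (c n / n) * z ^ n))
      (ofScalars ℝ (fun n => c (n + 1))) 0 (ENNReal.ofReal 1) := by
  have h := planarPressureAM_deriv_onBall (planarPressureAM_Phi_onBall c hle)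
  have e : (fun n : ℕ => ((n : ℝ) + 1) * (c (n + 1) / ((n + 1 : ℕ) : ℝ))) = fun n => c (n + 1) := by
    funext n
    have : ((n + 1 : ℕ) : ℝ) = (n : ℝ) + 1 := by push_cast; ring
    rw [this]
    field_simp
  rw [e] at h
  exact h

/-- `z Φ'(z) = G(z) - c₀` for `|z| < 1`. [folklore] -/
theorem planarPressureAM_mul_Phi_deriv (c : ℕ → ℝ) (hle : ∀ n, |c n| ≤ 1) {z : ℝ} (hz : |z| < 1) :
    z * deriv (fun z : ℝ => ∑' n, (c n / n) * z ^ n) z = (∑' n, c n * z ^ n) - c 0 := by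
  have hG := planarPressureAM_onBall_hasSum (planarPressureAM_G_onBall c hle) hz
  have hP := planarPressureAM_onBall_hasSum (planarPressureAM_Phi_deriv_onBall c hle) hz
  -- shift: z Φ'(z) = ∑ c'ₙ zⁿ with c'₀ = 0, c'ₙ₊₁ = cₙ₊₁
  have hS := planarPressureAM_hasSum_shift hP
    (b := fun n => if n = 0 then 0 else c n) (by simp) (fun n => by simp)
  -- difference G - z Φ' = c₀
  have hD := hG.sub hS
  have e : (fun n => c n * z ^ n - (if n = 0 then 0 else c n) * z ^ n)
      = fun n => if n = 0 then c 0 else 0 := by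
    funext n
    rcases n with _ | n
    · simp
    · simp
  rw [e] at hD
  have h1 : HasSum (fun n : ℕ => if n = 0 then c 0 else 0) (c 0) := hasSum_ite_eq 0 (c 0)
  have := hD.unique h1
  linarith

/-- The hypergeometric differential equation for `G = ∑ cₙ zⁿ` with the `₂F₁(½,½;1;·)` ratio
`4 (n+1)² cₙ₊₁ = (2n+1)² cₙ`, on `|z| < 1`: `z (1 - z) G'' + (1 - 2z) G' - G/4 = 0`. Proof:
termwise, the coefficient of `zⁿ` is `(n+1)² cₙ₊₁ - (n+½)² cₙ = 0`. [folklore] -/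
theorem planarPressureAM_hypergeometric_ode (c : ℕ → ℝ) (hle : ∀ n, |c n| ≤ 1)
    (hratio : ∀ n : ℕ, 4 * ((n : ℝ) + 1) ^ 2 * c (n + 1) = (2 * (n : ℝ) + 1) ^ 2 * c n)
    {z : ℝ} (hz : |z| < 1) :
    z * (1 - z) * deriv (deriv (fun z : ℝ => ∑' n, c n * z ^ n)) z
      + (1 - 2 * z) * deriv (fun z : ℝ => ∑' n, c n * z ^ n) z
      - (∑' n, c n * z ^ n) / 4 = 0 := by
  have hG1 := planarPressureAM_deriv_onBall (planarPressureAM_G_onBall c hle)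
  have hG2 := planarPressureAM_deriv_onBall hG1
  have h0 := planarPressureAM_onBall_hasSum (planarPressureAM_G_onBall c hle) hz
  have h1 := planarPressureAM_onBall_hasSum hG1 hz
  have h2 := planarPressureAM_onBall_hasSum hG2 hz
  -- z G''
  have hz2 := planarPressureAM_hasSum_shift h2
    (b := fun n => (n : ℝ) * ((n : ℝ) + 1) * c (n + 1)) (by simp) (fun n => by push_cast; ring)
  -- z (z G'')
  have hzz2 := planarPressureAM_hasSum_shift hz2
    (b := fun n => ((n : ℝ) - 1) * (n : ℝ) * c n) (by simp) (fun n => by push_cast; ring)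
  -- z G'
  have hz1 := planarPressureAM_hasSum_shift h1
    (b := fun n => (n : ℝ) * c n) (by simp) (fun n => by push_cast; ring)
  have hT := (((hz2.sub hzz2).add h1).sub (hz1.mul_left 2)).sub (h0.div_const 4)
  have e : ∀ n : ℕ, (n : ℝ) * ((n : ℝ) + 1) * c (n + 1) * z ^ n - ((n : ℝ) - 1) * (n : ℝ) * c n * z ^ n
      + ((n : ℝ) + 1) * c (n + 1) * z ^ n - 2 * ((n : ℝ) * c n * z ^ n) - c n * z ^ n / 4 = 0 := by
    intro n
    linear_combination (z ^ n / 4) * hratio n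
  have hT' := hT.congr_fun (g := fun _ : ℕ => (0 : ℝ)) (fun n => (e n).symm)
  have hv := hT'.unique hasSum_zero
  linear_combination hv

end Summit.CriticalPhenomena.Ising3DConformalLimit.Theorems
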